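import Mathlib
import Summits.ValiantsHypothesis.ValiantsHypothesis.Theorems.BarrierLeverTransversalMinorLayoutsCompressionBase
import Summits.ValiantsHypothesis.ValiantsHypothesis.Theorems.BarrierLeverResultantKernelSufficesForTransversal

/-!
# Route BarrierLever — conjecture TT (stmt-ValiantsHypothesis-19152): TT for RELABELED layouts

First consequences of the base case `Compression.pairing_good_of_iso` of the compression criterion
(`…CompressionBase`, p427869): the TT layout matrix `(det H[ρ_{u i}, τ_{w j}])_{i,j}` of item
19152 is nonsingular for some `H` whenever the column family `τ ∘ w` is a RELABELED COPY of the
row family `ρ ∘ u` — a symbol permutation of `Fin (h+h)`, a re-indexing of the members, and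
reorderings inside the members (`tt_layout_of_relabeling`).  Instances, for every `h`, `r` and every
injective `u`:
* `tt_layout_principal`: `w = u ∘ σ` (in particular the PRINCIPAL layouts `w = u`; cf. the tree's
  CT-level `ResultantKernel.resultantKernel_principal_layout_ne_zero`, here obtained at TT level in
  one line: `τ_s = flip ∘ ρ_s`);
* `tt_layout_compl`: `w j = (u (σ j))ᶜ` (here `τ_{sᶜ} = ρ_s` on the nose, `H` = identity matrix).

WHAT THIS IS NOT: TT for general layouts is open; nothing on crux 14610 / VP vs VNP.
-/

-- layout Summits/ValiantsHypothesis/ValiantsHypothesis forces the duplicated namespace component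
set_option linter.dupNamespace false

open Matrix Finset

namespace Summit.ValiantsHypothesis.ValiantsHypothesis.Theorems.BarrierLever.Compression

/-- Distinct subsets give row transversals with distinct ranges. -/
theorem rowT_image_injective (h : ℕ) {s s' : Finset (Fin h)}
    (e : Finset.univ.image (fun a : Fin h => if a ∈ s then Fin.castAdd h a else Fin.natAdd h a) =
      Finset.univ.image (fun a : Fin h => if a ∈ s' then Fin.castAdd h a else Fin.natAdd h a)) :
    s = s' := by
  ext a
  have key : ∀ (t t' : Finset (Fin h)), a ∈ t →
      Finset.univ.image (fun a : Fin h => if a ∈ t then Fin.castAdd h a else Fin.natAdd h a) =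
        Finset.univ.image (fun a : Fin h => if a ∈ t' then Fin.castAdd h a else Fin.natAdd h a) →
      a ∈ t' := by
    intro t t' hat htt'
    have hmem : Fin.castAdd h a ∈
        Finset.univ.image (fun a : Fin h => if a ∈ t' then Fin.castAdd h a else Fin.natAdd h a) := by
      rw [← htt']
      exact Finset.mem_image.mpr ⟨a, Finset.mem_univ _, by simp [hat]⟩
    obtain ⟨b, _, hb⟩ := Finset.mem_image.mp hmem
    by_cases hbt : b ∈ t'
    · rw [if_pos hbt] at hb
      have := Fin.castAdd_inj.mp hb
      subst this; exact hbt
    · rw [if_neg hbt] at hb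
      exfalso
      have hv := congrArg Fin.val hb
      simp [Fin.val_castAdd] at hv
      omega
  exact ⟨fun ha => key s s' ha e, fun ha => key s' s ha e.symm⟩

/-- TT for RELABELED layouts: if every column transversal `τ_{w j}` is the image under one symbol
permutation `π` of the row transversal `ρ_{u (σ j)}`, reordered by `τ j`, then the layout matrix
of item 19152 is nonsingular for some `H`. -/
theorem tt_layout_of_relabeling (h r : ℕ) (u w : Fin r → Finset (Fin h))
    (hu : Function.Injective u) (π : Equiv.Perm (Fin (h + h))) (σ : Equiv.Perm (Fin r))
    (τ : Fin r → Equiv.Perm (Fin h))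
    (hrel : ∀ j c, (if c ∈ w j then Fin.natAdd h c else Fin.castAdd h c) =
      π (if τ j c ∈ u (σ j) then Fin.castAdd h (τ j c) else Fin.natAdd h (τ j c))) :
    ∃ H : Matrix (Fin (h + h)) (Fin (h + h)) ℂ,
      (Matrix.of fun i j : Fin r => (H.submatrix
        (fun a : Fin h => if a ∈ u i then Fin.castAdd h a else Fin.natAdd h a)
        (fun c : Fin h => if c ∈ w j then Fin.natAdd h c else Fin.castAdd h c)).det).det ≠ 0 := by
  classical
  exact pairing_good_of_iso
    (fun (i : Fin r) (a : Fin h) => if a ∈ u i then Fin.castAdd h a else Fin.natAdd h a)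
    (fun (j : Fin r) (c : Fin h) => if c ∈ w j then Fin.natAdd h c else Fin.castAdd h c)
    (fun i => ResultantKernel.rowT_injective h (u i))
    (fun i i' e => hu (rowT_image_injective h e)) π σ τ (fun j c => hrel j c)

/-- TT for PRINCIPAL-TYPE layouts `w = u ∘ σ` (all `h`, `r`, injective `u`): the bit flip
`castAdd a ↔ natAdd a` carries `ρ_s` to `τ_s`. -/
theorem tt_layout_principal (h r : ℕ) (u : Fin r → Finset (Fin h)) (hu : Function.Injective u)
    (σ : Equiv.Perm (Fin r)) :
    ∃ H : Matrix (Fin (h + h)) (Fin (h + h)) ℂ,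
      (Matrix.of fun i j : Fin r => (H.submatrix
        (fun a : Fin h => if a ∈ u i then Fin.castAdd h a else Fin.natAdd h a)
        (fun c : Fin h => if c ∈ u (σ j) then Fin.natAdd h c else Fin.castAdd h c)).det).det ≠ 0 := by
  classical
  -- the flip permutation of `Fin (h + h)`: swap the two halves
  let flip : Equiv.Perm (Fin (h + h)) :=
    (finSumFinEquiv.symm.trans ((Equiv.sumComm (Fin h) (Fin h)).trans finSumFinEquiv))
  have hflip1 : ∀ a : Fin h, flip (Fin.castAdd h a) = Fin.natAdd h a := by
    intro a
    simp only [flip, Equiv.trans_apply, finSumFinEquiv_symm_apply_castAdd, Equiv.sumComm_apply,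
      Sum.swap_inl, finSumFinEquiv_apply_right]
  have hflip2 : ∀ a : Fin h, flip (Fin.natAdd h a) = Fin.castAdd h a := by
    intro a
    simp only [flip, Equiv.trans_apply, finSumFinEquiv_symm_apply_natAdd, Equiv.sumComm_apply,
      Sum.swap_inr, finSumFinEquiv_apply_left]
  refine tt_layout_of_relabeling h r u (u ∘ σ) hu flip σ (fun _ => Equiv.refl _) ?_
  intro j c
  simp only [Function.comp_apply, Equiv.refl_apply]
  by_cases hc : c ∈ u (σ j)
  · rw [if_pos hc, if_pos hc, hflip1]
  · rw [if_neg hc, if_neg hc, hflip2]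

/-- TT for COMPLEMENTED layouts `w j = (u (σ j))ᶜ` (all `h`, `r`, injective `u`): here the
column transversal of `sᶜ` IS the row transversal of `s`. -/
theorem tt_layout_compl (h r : ℕ) (u : Fin r → Finset (Fin h)) (hu : Function.Injective u)
    (σ : Equiv.Perm (Fin r)) :
    ∃ H : Matrix (Fin (h + h)) (Fin (h + h)) ℂ,
      (Matrix.of fun i j : Fin r => (H.submatrix
        (fun a : Fin h => if a ∈ u i then Fin.castAdd h a else Fin.natAdd h a)
        (fun c : Fin h => if c ∈ (u (σ j))ᶜ then Fin.natAdd h c else Fin.castAdd h c)).det).det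
        ≠ 0 := by
  classical
  refine tt_layout_of_relabeling h r u (fun j => (u (σ j))ᶜ) hu (Equiv.refl _) σ
    (fun _ => Equiv.refl _) ?_
  intro j c
  simp only [Equiv.refl_apply, Finset.mem_compl]
  by_cases hc : c ∈ u (σ j)
  · rw [if_neg (not_not.mpr hc), if_pos hc]
  · rw [if_pos hc, if_neg hc]

end Summit.ValiantsHypothesis.ValiantsHypothesis.Theorems.BarrierLever.Compression
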